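import Literature.AlgebraicGeometry.Hyperkaehler.GeneralizedKummerGysinKernel
import Literature.AlgebraicGeometry.Hyperkaehler.GeneralizedKummerPullbackInvariants
import Literature.AlgebraicGeometry.Hyperkaehler.IrreducibleSymplecticOfDeformationType
import Literature.AlgebraicGeometry.HodgeTheory.TotalCohomologyKunneth
import Literature.AlgebraicGeometry.Motives.AbelianVarietyCohomologyExteriorH1
import Literature.AlgebraicTopology.SingularHomology.KroneckerDegreeOne
import Literature.AlgebraicTopology.SingularHomology.FreeActionEulerCharacteristic
import HarnessLib

/-!
# `ker θ* = Ann([Kⁿ(A)])` is the ideal generated by `H¹(A^[n+1])` (Kapfer–Menet Prop. 5.7), and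
# `θ*` is onto `H²(Kⁿ(A))`, `H³(Kⁿ(A))` for `n ≥ 2` (Beauville §7 Prop. 8 / Kapfer–Menet Prop. 5.12 over `ℂ`)
# — PROVED modulo Beauville's Galois cover

Layer `Literature/AlgebraicGeometry/Hyperkaehler`; THEOREMS ONLY — no definition, no named fact, sorry-free
(D-0026).  Sequel of `GeneralizedKummerGysinKernel` (Kapfer–Menet Lemma 5.4 and Prop. 5.5 proved modulo the
named fact `HilbertScheme.Beauville1983_kummerCover_galois`) and of `GeneralizedKummerHilbertSchemePullback` (the
three NAMED FACTS of Kapfer–Menet §5, among them `KapferMenet2018_annihilator_eq_idealH1` = Prop. 5.7, and the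
vocabulary `cupAnnihilator`, `cupIdeal`, `kummerFibreClassTotal`).

S. Kapfer, G. Menet, *Integral cohomology of the generalized Kummer fourfold*, Algebraic Geometry 5 (2018) §5,
arXiv:1607.03431 pp. 13–14, `θ : K_{n−1}(A) ↪ A^[n]`, `[K] = θ_*(1)`:

* **Proposition 5.7** "The annihilator of `[K_{n−1}(A)]` in `H*(A^[n], ℚ)` is the ideal generated by `H¹(A^[n])`."
* **Proposition 5.12** "Assume `n ≥ 3`. Then `θ*` is surjective on `H²(A^[n], ℤ)`."  Its proof begins: "By
  [Beauville], `θ* : H²(A^[n], ℂ) → H²(K_{n−1}(A), ℂ)` is surjective" — A. Beauville, *Variétés kählériennes dont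
  la première classe de Chern est nulle*, J. Differential Geom. 18 (1983) §7, proof of Prop. 8 (p. 770): "nous
  allons montrer que l'homomorphisme `k* : H²(A^[r+1]) → H²(K_r)` est surjectif (dans la démonstration qui suit,
  la cohomologie est toujours à coefficients complexes)", `r ≥ 2`; only this statement over `ℂ` is proved here
  (the integral refinement through the Beauville–Bogomolov lattice is not recorded), together with its degree-`3`
  companion, which the same argument yields from the BNWS–Oguiso–Foster fact.

## How the proofs go (NOT the printed route of Prop. 5.7)

The printed proof of Prop. 5.7 (p. 14) runs through the Nakajima basis of `H*(A^[n])`, the super-symmetric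
powers `SSym^n(H*(A))` and a freeness lemma (Lemma 5.10) — vocabulary the tree does not have.  We prove the
statement through Beauville's Galois cover instead, with tree infrastructure only.  Data (exactly what the named
fact `Beauville1983_kummerCover_galois` provides): a finite regular cover `c` of `H(ℂ)` by `(A × K)(ℂ)` with
`c.proj = Θ(ℂ)`, `Θ = kummerCover act j : (a, ξ) ↦ t_a(j ξ)`, whose deck transformations are product maps
`(t_b × τ)(ℂ)`; `θ = j = Θ ∘ (1, 𝟙_K)`; `κ : H*(A) ⊗ H*(K) ≅ H*((A × K)(ℂ))` the Künneth isomorphism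
(`HodgeTheory.kunnethEquiv`, `a ⊗ b ↦ fst^* a ∪ snd^* b`).

* §0 plumbing: `g ∪ x ∈ ⟨H¹⟩` for `g ∈ H¹` (graded commutativity; the tree's `cupIdeal` is spanned by the
  products `x ∪ g`).
* §1 transfer on the TOTAL cohomology for a finite regular cover `c.proj = f(ℂ)` of complex points (from the
  tree's degreewise `FiniteDeckCover.map_proj_injective` / `mem_range_map_proj_of_invariant`): deck-invariant
  classes descend; the orbit sum `Σ_g g^*` lands in `im f^*`, fixes `im f^*` up to `|G|`, and is `im f^*`-linear
  (`f^*` is injective degreewise, used inline).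
* §2 the cover: translations act trivially on `H*(A(ℂ))` (`AbelianVariety.complexBetti_map_translate`), so
  `fst^* a` is deck-invariant and descends — in each degree; the orbit sum maps the left ideal
  `J_E = {fst^* g ∪ w | g ∈ H¹(A)}` into `Θ^*⟨H¹(H)⟩`, whence (**key lemma**) `Θ^* v ∈ J_E ⇒ v ∈ ⟨H¹(H)⟩`
  (`Θ^*` injective, `|G| ≠ 0` in `ℂ`).  Künneth side: `H⁰(A) = ℂ·1` and `Hᵏ(A)`, `k ≥ 1`, is spanned by products
  `g ∪ x'` with `g ∈ H¹(A)` (`AbelianVariety.hasExteriorCohomologyH1_complexPoints`), so every class of `A × K` is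
  `snd^* r + (element of J_E)`; the slice `(1, 𝟙_K)` kills `J_E` and `(1, 𝟙_K)^* snd^* r = r`.  Hence for
  `v ∈ ker θ^*`: `r = θ^* v = 0`, `Θ^* v ∈ J_E`, `v ∈ ⟨H¹(H)⟩`: **`ker θ^* ⊆ ⟨H¹(A^[n+1])⟩`**
  (`ker_totalPullback_le_cupIdeal_of_cover`).
* §3 Prop. 5.7: `Ann([K]) = ker θ^*` (Prop. 5.5 modulo the Galois fact, `GeneralizedKummerGysinKernel`) `⊆ ⟨H¹⟩`
  (§2); `⟨H¹⟩ ⊆ Ann([K])` is `cupIdeal_degreeOne_le_cupAnnihilator_of_h1` with `b₁(K) = 0` — for `m ≥ 1` from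
  Beauville's theorem that `Kᵐ(A)` is irreducible symplectic (the named fact
  `Beauville1983_irreducibleSymplectic_of_kummerType`), for `m = 0` because `dim K = 0`.  Net:
  `kapferMenet2018_annihilator_eq_idealH1_of_facts :
     Beauville1983_irreducibleSymplectic_of_kummerType → Beauville1983_kummerCover_galois →
     KapferMenet2018_annihilator_eq_idealH1`, and the headline `ker θ^* = ⟨H¹(A^[n+1])⟩` in the same conditional
  form.
* §4 Beauville Prop. 8 / KM Prop. 5.12 over `ℂ`: a class `r ∈ H*(K)` fixed by the `K`-components `τ` of all deck
  transformations has `snd^* r` deck-invariant, `= Θ^* s`, and `θ^* s = (1, 𝟙_K)^* snd^* r = r`; by the named fact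
  `BNWS2011_autFixingH2H3_generalizedKummer` (clause 1: Kummer translations by `A[m+1]` act trivially on `H²(K)`
  and `H³(K)`, `m ≥ 2`) this applies to every class of degree `2` or `3`:
  `θ^* : Hᵏ(A^[m+1](ℂ); ℂ) → Hᵏ(Kᵐ(A)(ℂ); ℂ)` is onto for `k = 2, 3`, `m ≥ 2`, modulo the two named facts.

Nothing here discharges `Beauville1983_kummerCover_galois`, `Beauville1983_irreducibleSymplectic_of_kummerType` or
`BNWS2011_autFixingH2H3_generalizedKummer`, and nothing here asserts V0 / L1 / any case of the Hodge conjecture.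
Count-neutral (0 new facts, 0 definitions).  Written for cell `hodge-kum4` (lane (V), literature typer).

## References

* [KapferMenet2018] S. Kapfer, G. Menet, Integral cohomology of the generalized Kummer fourfold, Algebraic
  Geometry 5 (2018) 523–567, Prop. 5.7 (pp. 13–14) and Prop. 5.12 (p. 14) (arXiv:1607.03431).
* [Beauville1983] A. Beauville, Variétés kählériennes dont la première classe de Chern est nulle, J. Differential
  Geom. 18 (1983), §7 p. 769 footnote 2 (the cartesian square `A × K_r → A^[r+1]` over `(r+1) : A → A`),
  Prop. 8 p. 769 ("`K_r` est simplement connexe; … pour `r ≥ 2`, `H²(K_r, ℂ) = j(H²(A, ℂ)) ⊕ ℂ·[F]`") with its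
  proof p. 770 (`k* : H²(A^[r+1]) → H²(K_r)` surjective over `ℂ`), Théorème 4.
* [BoissiereNieperWisskirchenSarti2011] S. Boissière, M. Nieper-Wißkirchen, A. Sarti, Higher dimensional Enriques
  varieties and automorphisms of generalized Kummer varieties, J. Math. Pures Appl. 95 (2011), §3.1 and Cor. 3.3.
* [HatcherAT2002] A. Hatcher, Algebraic Topology, CUP 2002, §3.G (transfer: Prop. 3G.1), §3.2 Thm. 3.16 (Künneth),
  Thm. 3.11 (graded commutativity).
* [LangeBirkenhake1992] H. Lange, Ch. Birkenhake, Complex Abelian Varieties, Springer 1992, Lemma 1.1.17 and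
  Exercise 1.1.6 (7) (`H•(A) = ⋀• H¹(A)`).
-/

noncomputable section

open CategoryTheory MonoidalCategory CartesianMonoidalCategory DirectSum TensorProduct
open Literature.AlgebraicTopology.SingularHomology
open Literature.AlgebraicGeometry.Motives (SchemeOver AbelianVariety ComplexPoints AlgPoints IsSmoothProjective)
open Literature.AlgebraicGeometry.HilbertScheme
open Literature.AlgebraicGeometry.HodgeTheory

namespace Literature.AlgebraicGeometry.Hyperkaehler

open scoped MonObj

universe u v

/-! ### §0 Plumbing: left multiples by `H¹` lie in the ideal `⟨H¹⟩` -/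

section Plumbing

variable {R : Type v} [CommRing R] {Z : Type u} [TopologicalSpace Z]

/-- **`g ∪ x ∈ ⟨H¹⟩` for `g ∈ H¹(Z)` and every `x ∈ H*(Z)`**: the tree's `cupIdeal` is spanned by the products
`x ∪ g`; for homogeneous `x ∈ Hᵏ`, `g ∪ x = (−1)ᵏ x ∪ g` (graded commutativity).
[cite: HatcherAT2002, §3.2 Thm. 3.11] [cite: KapferMenet2018, Prop. 5.7 p. 13] -/
theorem totalCup_ofDegree_one_mem_cupIdeal (g : singularCohomology R R Z 1) (x : totalCohomology R Z) :
    totalCup R Z (ofDegree R Z 1 g) x ∈ cupIdeal R Z (degreeClasses R Z {1}) := by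
  induction x using DirectSum.induction_on with
  | zero => rw [map_zero]; exact Submodule.zero_mem _
  | add x x' hx hx' => rw [map_add]; exact Submodule.add_mem _ hx hx'
  | of k y =>
    rw [← DirectSum.lof_eq_of R]
    change totalCup R Z (ofDegree R Z 1 g) (ofDegree R Z k y) ∈ _
    rw [totalCup_lof, cupProduct_gradedComm_holds R Z (rfl : 1 + k = 1 + k) (Nat.add_comm k 1) g y, map_smul,
      ofDegree_cupProduct_index (Nat.add_comm k 1) rfl y g, ← totalCup_lof]
    exact Submodule.smul_mem _ _ (totalCup_mem_cupIdeal _ (ofDegree_mem_degreeClasses (Set.mem_singleton 1) g))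

end Plumbing

/-! ### §1 Transfer on the total cohomology for a finite regular cover of complex points -/

section Transfer

variable {X Y : SchemeOver ℂ} {G : Type} [Group G] [Fintype G] [MulAction G (ComplexPoints X)]
  (c : FiniteDeckCover G (ComplexPoints X) (ComplexPoints Y))

/-- `g^* ∘ f^* = f^*` on the total cohomology for a deck transformation `g`. [cite: HatcherAT2002, §3.G p. 321] -/
theorem totalPullback_deck_totalPullback_proj (g : G) (x : totalCohomology ℂ (ComplexPoints Y)) :
    totalPullback ℂ (c.deck g) (totalPullback ℂ c.proj x) = totalPullback ℂ c.proj x := by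
  have hcomp : c.proj.comp (c.deck g) = c.proj := ContinuousMap.ext fun e ↦ c.proj_smul g e
  rw [← LinearMap.comp_apply, ← totalPullback_comp, hcomp]

/-- **Deck-invariant classes descend** (total cohomology): if `g^* y = y` for every `g ∈ G` then `y = f^* x` for
some `x` (degreewise the tree's `FiniteDeckCover.mem_range_map_proj_of_invariant`, assembled over the finite support
of `y`). [cite: HatcherAT2002, §3.G p. 321] -/
theorem exists_totalPullback_proj_eq_of_forall_deck (y : totalCohomology ℂ (ComplexPoints X))
    (hy : ∀ g : G, totalPullback ℂ (c.deck g) y = y) : ∃ x, totalPullback ℂ c.proj x = y := by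
  classical
  have hcomp : ∀ k : ℕ, ∃ xk : singularCohomology ℂ ℂ (ComplexPoints Y) k,
      singularCohomology.map ℂ ℂ c.proj k xk = y k := fun k ↦
    c.mem_range_map_proj_of_invariant k (y k) fun g ↦ by rw [← totalPullback_apply_apply, hy g]
  choose x hx using hcomp
  refine ⟨∑ k ∈ DFinsupp.support y, ofDegree ℂ (ComplexPoints Y) k (x k), ?_⟩
  rw [map_sum]
  conv_rhs => rw [← DirectSum.sum_support_of y]
  refine Finset.sum_congr rfl fun k _ ↦ ?_
  rw [totalPullback_lof, hx k, DirectSum.lof_eq_of]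

/-- Homogeneous form: a deck-invariant class of degree `k` is `f^*` of a class of degree `k`.
[cite: HatcherAT2002, §3.G p. 321] -/
theorem exists_totalPullback_proj_ofDegree_eq_of_forall_deck (k : ℕ) (yk : singularCohomology ℂ ℂ (ComplexPoints X) k)
    (hy : ∀ g : G, totalPullback ℂ (c.deck g) (ofDegree ℂ _ k yk) = ofDegree ℂ _ k yk) :
    ∃ xk : singularCohomology ℂ ℂ (ComplexPoints Y) k,
      totalPullback ℂ c.proj (ofDegree ℂ _ k xk) = ofDegree ℂ _ k yk := by
  have hy' : ∀ g : G, singularCohomology.map ℂ ℂ (c.deck g) k yk = yk := fun g ↦ by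
    have h := hy g
    rw [totalPullback_lof] at h
    exact DirectSum.of_injective k h
  obtain ⟨xk, hxk⟩ := c.mem_range_map_proj_of_invariant k yk hy'
  exact ⟨xk, by rw [totalPullback_lof, hxk]⟩

/-- **The orbit sum `Σ_g g^* w` is deck-invariant.** [cite: HatcherAT2002, §3.G p. 321] -/
theorem totalPullback_deck_sum_totalPullback_deck (h : G) (w : totalCohomology ℂ (ComplexPoints X)) :
    totalPullback ℂ (c.deck h) (∑ g, totalPullback ℂ (c.deck g) w) = ∑ g, totalPullback ℂ (c.deck g) w := by
  rw [map_sum]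
  have hterm : ∀ g : G, totalPullback ℂ (c.deck h) (totalPullback ℂ (c.deck g) w) =
      totalPullback ℂ (c.deck (g * h)) w := fun g ↦ by
    rw [← LinearMap.comp_apply, ← totalPullback_comp, c.deck_mul]
  simp_rw [hterm]
  exact Fintype.sum_equiv (Equiv.mulRight h) _ _ fun g ↦ rfl

/-- **The orbit sum lands in `im f^*`.** [cite: HatcherAT2002, §3.G p. 321] -/
theorem exists_totalPullback_proj_eq_sum_deck (w : totalCohomology ℂ (ComplexPoints X)) :
    ∃ s, totalPullback ℂ c.proj s = ∑ g, totalPullback ℂ (c.deck g) w :=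
  exists_totalPullback_proj_eq_of_forall_deck c _ (totalPullback_deck_sum_totalPullback_deck c · w)

/-- **On `im f^*` the orbit sum is multiplication by `|G|`.** [cite: HatcherAT2002, §3.G Prop. 3G.1] -/
theorem sum_totalPullback_deck_totalPullback_proj (x : totalCohomology ℂ (ComplexPoints Y)) :
    ∑ g, totalPullback ℂ (c.deck g) (totalPullback ℂ c.proj x) = (Fintype.card G : ℂ) • totalPullback ℂ c.proj x := by
  simp_rw [totalPullback_deck_totalPullback_proj]
  rw [Finset.sum_const, Finset.card_univ, Nat.cast_smul_eq_nsmul]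

/-- **The orbit sum is `im f^*`-linear**: `Σ_g g^*(f^* x ∪ w) = f^* x ∪ Σ_g g^* w` (each `g^*` is a ring map fixing
`f^* x`). [cite: HatcherAT2002, §3.G p. 321 and §3.2 Prop. 3.10] -/
theorem sum_totalPullback_deck_totalCup (x : totalCohomology ℂ (ComplexPoints Y))
    (w : totalCohomology ℂ (ComplexPoints X)) :
    ∑ g, totalPullback ℂ (c.deck g) (totalCup ℂ _ (totalPullback ℂ c.proj x) w) =
      totalCup ℂ _ (totalPullback ℂ c.proj x) (∑ g, totalPullback ℂ (c.deck g) w) := by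
  rw [map_sum]
  refine Finset.sum_congr rfl fun g _ ↦ ?_
  rw [totalPullback_totalCup, totalPullback_deck_totalPullback_proj]

end Transfer

/-! ### §2 Beauville's cover `Θ : A × K → A^[n+1]`: the key lemma `Θ^* v ∈ J_E ⇒ v ∈ ⟨H¹(H)⟩` and `ker θ^* ⊆ ⟨H¹⟩` -/

section Cover

variable {A : AbelianVariety ℂ} {K H : SchemeOver ℂ}

/-- **`(t_b × τ)(ℂ)^* (fst^* a) = fst^* a`**: a product map with a translation in the `A`-factor fixes every class
pulled back from `A` — `t_b^* = id` on `H*(A(ℂ); ℂ)` (translations of the connected group `A(ℂ)`: the tree's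
`AbelianVariety.complexBetti_map_translate` degreewise, assembled over `⨁ₖ Hᵏ`).
[cite: MumfordAV1970, §1 (1)–(2)] [cite: Beauville1983, §7 p. 769 footnote 2] [cite: HatcherAT2002, §3.2 p. 210] -/
theorem totalPullback_translate_tensorHom_totalPullback_fst (b : 𝟙_ (SchemeOver ℂ) ⟶ A.X) (τ : K ⟶ K)
    (a : totalCohomology ℂ (ComplexPoints A.X)) :
    totalPullback ℂ (AlgPoints.mapContinuous (L := ℂ) (A.translate b ⊗ₘ τ))
        (totalPullback ℂ (AlgPoints.mapContinuous (L := ℂ) (fst A.X K)) a) =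
      totalPullback ℂ (AlgPoints.mapContinuous (L := ℂ) (fst A.X K)) a := by
  -- `t_b^* = id` on the total cohomology of `A`
  have ht : totalPullback ℂ (AlgPoints.mapContinuous (L := ℂ) (A.translate b)) = LinearMap.id := by
    refine DirectSum.linearMap_ext ℂ fun k ↦ LinearMap.ext fun x ↦ ?_
    simp only [LinearMap.coe_comp, Function.comp_apply, totalPullback_lof, LinearMap.id_coe, id_eq]
    exact congrArg _ (Motives.AbelianVariety.complexBetti_map_translate_apply b k x)
  rw [← LinearMap.comp_apply, ← totalPullback_comp, ← Motives.AlgPoints.mapContinuous_comp, tensorHom_fst,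
    Motives.AlgPoints.mapContinuous_comp, totalPullback_comp, LinearMap.comp_apply, ht, LinearMap.id_apply]

/-- **`(t_b × τ)(ℂ)^* (snd^* r) = snd^* (τ(ℂ)^* r)`**: on classes pulled back from `K` a product map acts through its
`K`-component. [cite: Beauville1983, §7 p. 769 footnote 2] [cite: HatcherAT2002, §3.2 p. 210] -/
theorem totalPullback_translate_tensorHom_totalPullback_snd (b : 𝟙_ (SchemeOver ℂ) ⟶ A.X) (τ : K ⟶ K)
    (r : totalCohomology ℂ (ComplexPoints K)) :
    totalPullback ℂ (AlgPoints.mapContinuous (L := ℂ) (A.translate b ⊗ₘ τ))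
        (totalPullback ℂ (AlgPoints.mapContinuous (L := ℂ) (snd A.X K)) r) =
      totalPullback ℂ (AlgPoints.mapContinuous (L := ℂ) (snd A.X K))
        (totalPullback ℂ (AlgPoints.mapContinuous (L := ℂ) τ) r) := by
  rw [← LinearMap.comp_apply, ← totalPullback_comp, ← Motives.AlgPoints.mapContinuous_comp, tensorHom_snd,
    Motives.AlgPoints.mapContinuous_comp, totalPullback_comp, LinearMap.comp_apply]

/-- **The slice `(y₀, 𝟙_K)` is a section of `snd`: `(y₀, 𝟙_K)^* snd^* r = r`.** [cite: HatcherAT2002, §3.2 p. 210] -/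
theorem totalPullback_sliceRight_totalPullback_snd (y₀ : 𝟙_ (SchemeOver ℂ) ⟶ A.X)
    (r : totalCohomology ℂ (ComplexPoints K)) :
    totalPullback ℂ (AlgPoints.mapContinuous (L := ℂ) (Motives.sliceRight y₀ K))
        (totalPullback ℂ (AlgPoints.mapContinuous (L := ℂ) (snd A.X K)) r) = r := by
  rw [← LinearMap.comp_apply, ← totalPullback_comp, mapContinuous_sliceRight_snd, totalPullback_id,
    LinearMap.id_apply]

/-- **The slice `(y₀, 𝟙_K)` kills the left ideal `J_E = span{fst^* g ∪ w | g ∈ H¹(A)}`**: `fst ∘ (y₀, 𝟙_K)` is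
constant, and a constant map kills classes of positive degree. [cite: HatcherAT2002, §3.1 p. 199 and §3.2 p. 210] -/
theorem totalPullback_sliceRight_eq_zero_of_mem_span (y₀ : 𝟙_ (SchemeOver ℂ) ⟶ A.X)
    {z : totalCohomology ℂ (ComplexPoints (A.X ⊗ K))}
    (hz : z ∈ Submodule.span ℂ {z | ∃ (g₁ : complexBetti A.X 1) (w : totalCohomology ℂ (ComplexPoints (A.X ⊗ K))),
      z = totalCup ℂ _ (totalPullback ℂ (AlgPoints.mapContinuous (L := ℂ) (fst A.X K)) (ofDegree ℂ _ 1 g₁)) w}) :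
    totalPullback ℂ (AlgPoints.mapContinuous (L := ℂ) (Motives.sliceRight y₀ K)) z = 0 := by
  induction hz using Submodule.span_induction with
  | zero => rw [map_zero]
  | add z z' _ _ hz hz' => rw [map_add, hz, hz', add_zero]
  | smul r z _ hz => rw [map_smul, hz, smul_zero]
  | mem z hz =>
    obtain ⟨g₁, w, rfl⟩ := hz
    have h0 : totalPullback ℂ (AlgPoints.mapContinuous (L := ℂ) (Motives.sliceRight y₀ K))
        (totalPullback ℂ (AlgPoints.mapContinuous (L := ℂ) (fst A.X K)) (ofDegree ℂ _ 1 g₁)) = 0 := by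
      rw [← LinearMap.comp_apply, ← totalPullback_comp, mapContinuous_sliceRight_fst, totalPullback_lof,
        singularCohomology_map_const one_ne_zero, map_zero]
    rw [totalPullback_totalCup, h0, map_zero, LinearMap.zero_apply]

/-- **Künneth side: every class of `A × K` is `snd^* r` modulo `J_E`.**  For `t ∈ H*(A) ⊗ H*(K)` there is
`r ∈ H*(K)` with `κ t − snd^* r ∈ J_E`: `H⁰(A(ℂ)) = ℂ · 1` (`A(ℂ)` connected) gives `κ(a₀ ⊗ b) = c · snd^* b` for
`a₀ ∈ H⁰`, and `Hᵏ(A(ℂ); ℂ)`, `k ≥ 1`, is spanned by products `g ∪ x'` with `g ∈ H¹` (`H•(A) = ⋀• H¹(A)`: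
`AbelianVariety.hasExteriorCohomologyH1_complexPoints`, `cupPowOne_succ`), so `κ((g ∪ x') ⊗ b) =
fst^* g ∪ (fst^* x' ∪ snd^* b) ∈ J_E`. [cite: LangeBirkenhake1992, Exercise 1.1.6 (7)] [cite: HatcherAT2002, §3.2 Thm. 3.16] -/
theorem exists_kunnethCross_sub_snd_mem_span (hS : IsSmoothProjective 2 A.X)
    (t : totalCohomology ℂ (ComplexPoints A.X) ⊗[ℂ] totalCohomology ℂ (ComplexPoints K)) :
    ∃ r : totalCohomology ℂ (ComplexPoints K), kunnethCross A.X K t -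
        totalPullback ℂ (AlgPoints.mapContinuous (L := ℂ) (snd A.X K)) r ∈
      Submodule.span ℂ {z | ∃ (g₁ : complexBetti A.X 1) (w : totalCohomology ℂ (ComplexPoints (A.X ⊗ K))),
        z = totalCup ℂ _ (totalPullback ℂ (AlgPoints.mapContinuous (L := ℂ) (fst A.X K)) (ofDegree ℂ _ 1 g₁)) w} := by
  induction t using TensorProduct.induction_on with
  | zero => exact ⟨0, by rw [map_zero, map_zero, sub_zero]; exact Submodule.zero_mem _⟩
  | add t t' ht ht' =>
    obtain ⟨r, hr⟩ := ht
    obtain ⟨r', hr'⟩ := ht'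
    exact ⟨r + r', by rw [map_add, map_add, add_sub_add_comm]; exact Submodule.add_mem _ hr hr'⟩
  | tmul a b =>
    induction a using DirectSum.induction_on with
    | zero => exact ⟨0, by rw [TensorProduct.zero_tmul, map_zero, map_zero, sub_zero]; exact Submodule.zero_mem _⟩
    | add a a' ha ha' =>
      obtain ⟨r, hr⟩ := ha
      obtain ⟨r', hr'⟩ := ha'
      exact ⟨r + r', by rw [TensorProduct.add_tmul, map_add, map_add, add_sub_add_comm]; exact Submodule.add_mem _ hr hr'⟩
    | of k a =>
      rw [← DirectSum.lof_eq_of ℂ]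
      change ∃ r, kunnethCross A.X K (ofDegree ℂ (ComplexPoints A.X) k a ⊗ₜ b) - _ ∈ _
      cases k with
      | zero =>
        -- `a = c₀ • 1`, `κ(1 ⊗ b) = snd^* b`
        obtain ⟨c₀, hc₀⟩ := exists_eq_smul_one_of_isSmoothProjective hS ℂ a
        refine ⟨c₀ • b, ?_⟩
        rw [hc₀, map_smul, ← TensorProduct.smul_tmul', map_smul, map_smul, totalCross_one_tmul, sub_self]
        exact Submodule.zero_mem _
      | succ k' =>
        -- `a ∈ H^{k'+1}(A)` is a combination of products `g ∪ y`, `g ∈ H¹(A)`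
        refine ⟨0, ?_⟩
        rw [map_zero, sub_zero]
        have ha : a ∈ Submodule.span ℂ (Set.range (cupPowOne ℂ (ComplexPoints A.X) (k' + 1))) := by
          rw [(Motives.AbelianVariety.hasExteriorCohomologyH1_complexPoints A).span_range_cupPowOne (k' + 1)]
          trivial
        induction ha using Submodule.span_induction with
        | zero => rw [map_zero, TensorProduct.zero_tmul, map_zero]; exact Submodule.zero_mem _
        | add a a' _ _ ha ha' =>
          rw [map_add, TensorProduct.add_tmul, map_add]; exact Submodule.add_mem _ ha ha'
        | smul r a _ ha => rw [map_smul, ← TensorProduct.smul_tmul', map_smul]; exact Submodule.smul_mem _ r ha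
        | mem a ha =>
          obtain ⟨v, rfl⟩ := ha
          rw [cupPowOne_succ, ofDegree_cupProduct_index (Nat.add_comm 1 k') rfl, ← totalCup_lof, totalCross_tmul,
            totalPullback_totalCup, totalCup_assoc]
          exact Submodule.subset_span ⟨v 0, _, rfl⟩

variable {G : Type} [Group G] [Fintype G] [MulAction G (ComplexPoints (A.X ⊗ K))]
  (c : FiniteDeckCover G (ComplexPoints (A.X ⊗ K)) (ComplexPoints H)) {Θ : A.X ⊗ K ⟶ H}
  (hc : c.proj = AlgPoints.mapContinuous (L := ℂ) Θ)
  (hdeck : ∀ g : G, ∃ (b : 𝟙_ (SchemeOver ℂ) ⟶ A.X) (τ : K ⟶ K),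
    c.deck g = AlgPoints.mapContinuous (L := ℂ) (A.translate b ⊗ₘ τ))

include hdeck in
/-- **Deck transformations of Beauville's cover fix `fst^* H*(A)` pointwise** (they are `(t_b × τ)(ℂ)` and
`t_b^* = id`). [cite: Beauville1983, §7 p. 769 footnote 2] [cite: KapferMenet2018, Lemma 5.4 (proof) p. 13] -/
theorem totalPullback_deck_totalPullback_fst (g : G) (a : totalCohomology ℂ (ComplexPoints A.X)) :
    totalPullback ℂ (c.deck g) (totalPullback ℂ (AlgPoints.mapContinuous (L := ℂ) (fst A.X K)) a) =
      totalPullback ℂ (AlgPoints.mapContinuous (L := ℂ) (fst A.X K)) a := by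
  obtain ⟨b, τ, hg⟩ := hdeck g
  rw [hg, totalPullback_translate_tensorHom_totalPullback_fst]

include hc hdeck in
/-- **`fst^* a = Θ^* x` degree by degree**: a class pulled back from `A` is deck-invariant, hence descends to `H`,
in the same degree. [cite: HatcherAT2002, §3.G p. 321] [cite: Beauville1983, §7 p. 769 footnote 2] -/
theorem exists_totalPullback_ofDegree_eq_totalPullback_fst (k : ℕ) (a : complexBetti A.X k) :
    ∃ x : complexBetti H k, totalPullback ℂ (AlgPoints.mapContinuous (L := ℂ) Θ) (ofDegree ℂ _ k x) =
      totalPullback ℂ (AlgPoints.mapContinuous (L := ℂ) (fst A.X K)) (ofDegree ℂ _ k a) := by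
  obtain ⟨x, hx⟩ := exists_totalPullback_proj_ofDegree_eq_of_forall_deck c k
    (singularCohomology.map ℂ ℂ (AlgPoints.mapContinuous (L := ℂ) (fst A.X K)) k a) fun g ↦ by
      rw [← totalPullback_lof, totalPullback_deck_totalPullback_fst c hdeck g]
  exact ⟨x, by rw [← hc, hx, totalPullback_lof]⟩

include hc hdeck in
/-- **The orbit sum maps `J_E = span{fst^* g ∪ w | g ∈ H¹(A)}` into `Θ^*⟨H¹(H)⟩`**:
`Σ_g g^*(fst^* g₁ ∪ w) = fst^* g₁ ∪ Σ_g g^* w = Θ^* γ ∪ Θ^* s = Θ^*(γ ∪ s)` with `γ ∈ H¹(H)` (descent of `fst^* g₁`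
in degree `1`) and `Θ^* s = Σ_g g^* w` (descent of the orbit sum), and `γ ∪ s ∈ ⟨H¹(H)⟩`.
[cite: HatcherAT2002, §3.G p. 321] [cite: KapferMenet2018, Prop. 5.7 pp. 13–14] -/
theorem sum_totalPullback_deck_mem_map_cupIdeal {z : totalCohomology ℂ (ComplexPoints (A.X ⊗ K))}
    (hz : z ∈ Submodule.span ℂ {z | ∃ (g₁ : complexBetti A.X 1) (w : totalCohomology ℂ (ComplexPoints (A.X ⊗ K))),
      z = totalCup ℂ _ (totalPullback ℂ (AlgPoints.mapContinuous (L := ℂ) (fst A.X K)) (ofDegree ℂ _ 1 g₁)) w}) :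
    ∑ g, totalPullback ℂ (c.deck g) z ∈
      (cupIdeal ℂ (ComplexPoints H) (degreeClasses ℂ (ComplexPoints H) {1})).map
        (totalPullback ℂ (AlgPoints.mapContinuous (L := ℂ) Θ)) := by
  induction hz using Submodule.span_induction with
  | zero => rw [Finset.sum_eq_zero fun g _ ↦ by rw [map_zero]]; exact Submodule.zero_mem _
  | add z z' _ _ hz hz' =>
    simp only [map_add, Finset.sum_add_distrib]
    exact Submodule.add_mem _ hz hz'
  | smul r z _ hz =>
    simp only [map_smul, ← Finset.smul_sum]
    exact Submodule.smul_mem _ r hz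
  | mem z hz =>
    obtain ⟨g₁, w, rfl⟩ := hz
    obtain ⟨x₁, hx₁⟩ := exists_totalPullback_ofDegree_eq_totalPullback_fst c hc hdeck 1 g₁
    obtain ⟨s, hs⟩ := exists_totalPullback_proj_eq_sum_deck c w
    rw [← hx₁, ← hc, sum_totalPullback_deck_totalCup, ← hs, ← totalPullback_totalCup]
    exact Submodule.mem_map_of_mem (totalCup_ofDegree_one_mem_cupIdeal x₁ s)

include hc hdeck in
/-- **Key lemma: `Θ^* v ∈ J_E ⇒ v ∈ ⟨H¹(H)⟩`.**  Apply the orbit sum: `|G| • Θ^* v = Σ_g g^* Θ^* v ∈ Θ^*⟨H¹(H)⟩`,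
so `|G| • v ∈ ⟨H¹(H)⟩` by injectivity of `Θ^*`, and `|G| ≠ 0` in `ℂ`.
[cite: HatcherAT2002, §3.G Prop. 3G.1] [cite: KapferMenet2018, Prop. 5.7 pp. 13–14] -/
theorem mem_cupIdeal_of_totalPullback_mem_span (v : totalCohomology ℂ (ComplexPoints H))
    (hv : totalPullback ℂ (AlgPoints.mapContinuous (L := ℂ) Θ) v ∈
      Submodule.span ℂ {z | ∃ (g₁ : complexBetti A.X 1) (w : totalCohomology ℂ (ComplexPoints (A.X ⊗ K))),
        z = totalCup ℂ _ (totalPullback ℂ (AlgPoints.mapContinuous (L := ℂ) (fst A.X K)) (ofDegree ℂ _ 1 g₁)) w}) :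
    v ∈ cupIdeal ℂ (ComplexPoints H) (degreeClasses ℂ (ComplexPoints H) {1}) := by
  have hG : (Fintype.card G : ℂ) ≠ 0 := Nat.cast_ne_zero.mpr Fintype.card_ne_zero
  obtain ⟨u, hu, hu'⟩ := Submodule.mem_map.mp (sum_totalPullback_deck_mem_map_cupIdeal c hc hdeck hv)
  rw [← hc, sum_totalPullback_deck_totalPullback_proj, ← map_smul] at hu'
  -- `Θ^*` is injective on the total cohomology (degreewise the tree's `FiniteDeckCover.map_proj_injective`)
  have huv : u = (Fintype.card G : ℂ) • v := by
    refine DFinsupp.ext fun k ↦ c.map_proj_injective k ?_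
    rw [← totalPullback_apply_apply, ← totalPullback_apply_apply, hu']
  have hvu : v = (Fintype.card G : ℂ)⁻¹ • u := by rw [huv, smul_smul, inv_mul_cancel₀ hG, one_smul]
  rw [hvu]
  exact Submodule.smul_mem _ _ hu

include hc hdeck in
/-- **`ker θ^* ⊆ ⟨H¹(A^[n+1])⟩` from the cover data** (`A` an abelian surface — only `H⁰(A(ℂ)) = ℂ·1` and
`H•(A) = ⋀•H¹(A)` are used —, `K` smooth projective, `θ = j = Θ ∘ (1, 𝟙_K)`, `c.proj = Θ(ℂ)` a finite regular
cover with deck transformations `(t_b × τ)(ℂ)`): for `v ∈ ker θ^*` write `Θ^* v = κ t = snd^* r + z`, `z ∈ J_E`;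
restricting to the slice, `0 = θ^* v = r`; so `Θ^* v ∈ J_E` and `v ∈ ⟨H¹(H)⟩` by the key lemma.
[cite: KapferMenet2018, Prop. 5.7 pp. 13–14] [cite: Beauville1983, §7 p. 769 footnote 2] -/
theorem ker_totalPullback_le_cupIdeal_of_cover {m : ℕ} (hS : IsSmoothProjective 2 A.X)
    (hKs : IsSmoothProjective m K) {j : K ⟶ H}
    (hιΘ : lift (toUnit K ≫ (1 : 𝟙_ (SchemeOver ℂ) ⟶ A.X)) (𝟙 K) ≫ Θ = j) :
    LinearMap.ker (totalPullback ℂ (AlgPoints.mapContinuous (L := ℂ) j)) ≤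
      cupIdeal ℂ (ComplexPoints H) (degreeClasses ℂ (ComplexPoints H) {1}) := by
  intro v hv
  rw [LinearMap.mem_ker] at hv
  obtain ⟨t, ht⟩ := kunnethCross_surjective hS hKs (totalPullback ℂ (AlgPoints.mapContinuous (L := ℂ) Θ) v)
  obtain ⟨r, hr⟩ := exists_kunnethCross_sub_snd_mem_span (K := K) hS t
  -- `θ^* = (1, 𝟙_K)^* ∘ Θ^*`
  have hθ : totalPullback ℂ (AlgPoints.mapContinuous (L := ℂ) j) v =
      totalPullback ℂ (AlgPoints.mapContinuous (L := ℂ) (Motives.sliceRight (1 : 𝟙_ (SchemeOver ℂ) ⟶ A.X) K))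
        (totalPullback ℂ (AlgPoints.mapContinuous (L := ℂ) Θ) v) := by
    rw [← hιΘ, Motives.AlgPoints.mapContinuous_comp, totalPullback_comp, LinearMap.comp_apply]
    rfl
  -- `r = θ^* v = 0`
  have hr0 : r = 0 := by
    have h := totalPullback_sliceRight_eq_zero_of_mem_span (1 : 𝟙_ (SchemeOver ℂ) ⟶ A.X) hr
    rwa [map_sub, totalPullback_sliceRight_totalPullback_snd, ht, ← hθ, hv, zero_sub, neg_eq_zero] at h
  rw [hr0, map_zero, sub_zero, ht] at hr
  exact mem_cupIdeal_of_totalPullback_mem_span c hc hdeck v hr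

include hc in
/-- **A class of `K` fixed by the `K`-components of all deck transformations is a restriction from `H`**:
if `τ_g^* r = r` for every `g` (deck `g = (t_b × τ_g)(ℂ)`), then `snd^* r` is deck-invariant, `snd^* r = Θ^* s`,
and `θ^* s = (1, 𝟙_K)^* snd^* r = r`. [cite: Beauville1983, §7 Prop. 8 (proof, p. 770)] [cite: HatcherAT2002, §3.G p. 321] -/
theorem exists_totalPullback_eq_of_forall_deck_snd {j : K ⟶ H}
    (hιΘ : lift (toUnit K ≫ (1 : 𝟙_ (SchemeOver ℂ) ⟶ A.X)) (𝟙 K) ≫ Θ = j)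
    (r : totalCohomology ℂ (ComplexPoints K))
    (hr : ∀ g : G, ∃ (b : 𝟙_ (SchemeOver ℂ) ⟶ A.X) (τ : K ⟶ K),
      c.deck g = AlgPoints.mapContinuous (L := ℂ) (A.translate b ⊗ₘ τ) ∧
        totalPullback ℂ (AlgPoints.mapContinuous (L := ℂ) τ) r = r) :
    ∃ s : totalCohomology ℂ (ComplexPoints H), totalPullback ℂ (AlgPoints.mapContinuous (L := ℂ) j) s = r := by
  obtain ⟨s, hs⟩ := exists_totalPullback_proj_eq_of_forall_deck c
    (totalPullback ℂ (AlgPoints.mapContinuous (L := ℂ) (snd A.X K)) r) fun g ↦ by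
      obtain ⟨b, τ, hg, hτ⟩ := hr g
      rw [hg, totalPullback_translate_tensorHom_totalPullback_snd, hτ]
  refine ⟨s, ?_⟩
  rw [← hιΘ, Motives.AlgPoints.mapContinuous_comp, totalPullback_comp, LinearMap.comp_apply, ← hc, hs]
  exact totalPullback_sliceRight_totalPullback_snd 1 r

include hc in
/-- Degreewise form: a class `y ∈ Hᵏ(K)` with `τ_g^* y = y` for all `g` is `θ^* x`, `x ∈ Hᵏ(H)`.
[cite: Beauville1983, §7 Prop. 8 (proof, p. 770)] [cite: HatcherAT2002, §3.G p. 321] -/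
theorem exists_complexBetti_map_eq_of_forall_deck_snd {j : K ⟶ H}
    (hιΘ : lift (toUnit K ≫ (1 : 𝟙_ (SchemeOver ℂ) ⟶ A.X)) (𝟙 K) ≫ Θ = j) (k : ℕ) (y : complexBetti K k)
    (hr : ∀ g : G, ∃ (b : 𝟙_ (SchemeOver ℂ) ⟶ A.X) (τ : K ⟶ K),
      c.deck g = AlgPoints.mapContinuous (L := ℂ) (A.translate b ⊗ₘ τ) ∧ complexBetti.map τ k y = y) :
    ∃ x : complexBetti H k, complexBetti.map j k x = y := by
  obtain ⟨s, hs⟩ := exists_totalPullback_eq_of_forall_deck_snd c hc hιΘ (ofDegree ℂ _ k y) fun g ↦ by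
    obtain ⟨b, τ, hg, hτ⟩ := hr g
    have hτ' : singularCohomology.map ℂ ℂ (AlgPoints.mapContinuous (L := ℂ) τ) k y = y := hτ
    exact ⟨b, τ, hg, by rw [totalPullback_lof, hτ']⟩
  refine ⟨s k, ?_⟩
  have h := congrArg (fun v : totalCohomology ℂ (ComplexPoints K) ↦ v k) hs
  simp only at h
  rw [totalPullback_apply_apply, DirectSum.lof_eq_of, DirectSum.of_eq_same] at h
  exact h

end Cover

/-! ### §3 Kapfer–Menet Proposition 5.7 modulo Beauville's two theorems -/

section KapferMenet

variable {m : ℕ} {A : AbelianVariety ℂ} {K H : SchemeOver ℂ}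

/-- **`ker θ^* ⊆ ⟨H¹(A^[m+1])⟩` for a generalized Kummer fibre, modulo Beauville's Galois cover**
(`Beauville1983_kummerCover_galois`): instantiate `ker_totalPullback_le_cupIdeal_of_cover` with the translation
action (`translationAction`, PROVED to be one), `Θ = kummerCover act j`, `(1, 𝟙_K) ≫ Θ = j`
(`IsTranslationAction.lift_one_id_comp_kummerCover`) and the cover structure of the fact.
[cite: KapferMenet2018, Prop. 5.7 pp. 13–14] [cite: Beauville1983, §7 p. 769 footnote 2] -/
theorem ker_totalPullback_le_cupIdeal_of_galois (hgal : Beauville1983_kummerCover_galois) (hA : A.dim = 2)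
    (Ξ : (A.X ⊗ H).left.IdealSheafData) (𝒜 : Motives.Jacobian H) (x₀ : 𝟙_ (SchemeOver ℂ) ⟶ H) (j : K ⟶ H)
    (hHilb : IsHilbertSchemeOfPoints (m + 1) A.X H Ξ) (hH : IsSmoothProjective (2 * (m + 1)) H)
    (hsq : IsPullback j (toUnit K) (lift (𝟙 H) (toUnit H ≫ x₀) ≫ 𝒜.diff) (1 : 𝟙_ (SchemeOver ℂ) ⟶ 𝒜.J.X))
    (hKs : IsSmoothProjective (2 * m) K) :
    LinearMap.ker (totalPullback ℂ (AlgPoints.mapContinuous (L := ℂ) j)) ≤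
      cupIdeal ℂ (ComplexPoints H) (degreeClasses ℂ (ComplexPoints H) {1}) := by
  classical
  have hact : IsTranslationAction Ξ (translationAction hHilb) := isTranslationAction_translationAction hHilb
  obtain ⟨G, _, _, _, c, hc, -, hdeck, -⟩ := hgal hA Ξ 𝒜 x₀ j (translationAction hHilb) hHilb hH hsq hKs hact
  have hdeck' : ∀ g : G, ∃ (b : 𝟙_ (SchemeOver ℂ) ⟶ A.X) (τ : K ⟶ K),
      c.deck g = AlgPoints.mapContinuous (L := ℂ) (A.translate b ⊗ₘ τ) := fun g ↦ by
    obtain ⟨b, τ, -, -, hg⟩ := hdeck g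
    exact ⟨b⁻¹, τ, hg⟩
  have hS : IsSmoothProjective 2 A.X := hA ▸ Motives.AbelianVariety.isSmoothProjective_holds
  exact ker_totalPullback_le_cupIdeal_of_cover c hc hdeck' hS hKs (hact.lift_one_id_comp_kummerCover hHilb j)

/-- **`Ann([K]) ⊆ ⟨H¹(A^[m+1])⟩` modulo Beauville's Galois cover**: `Ann([K]) = ker θ^*` (Prop. 5.5 modulo the
fact, `kapferMenet2018_ker_pullback_eq_annihilator_of_galois`) and `ker θ^* ⊆ ⟨H¹⟩`.
[cite: KapferMenet2018, Prop. 5.7 pp. 13–14 and Prop. 5.5 p. 13] -/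
theorem cupAnnihilator_le_cupIdeal_of_galois (hgal : Beauville1983_kummerCover_galois) (hA : A.dim = 2)
    (Ξ : (A.X ⊗ H).left.IdealSheafData) (𝒜 : Motives.Jacobian H) (x₀ : 𝟙_ (SchemeOver ℂ) ⟶ H) (j : K ⟶ H)
    (hHilb : IsHilbertSchemeOfPoints (m + 1) A.X H Ξ) (hH : IsSmoothProjective (2 * (m + 1)) H)
    (hsq : IsPullback j (toUnit K) (lift (𝟙 H) (toUnit H ≫ x₀) ≫ 𝒜.diff) (1 : 𝟙_ (SchemeOver ℂ) ⟶ 𝒜.J.X))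
    (hKs : IsSmoothProjective (2 * m) K) :
    cupAnnihilator ℂ (ComplexPoints H) (kummerFibreClassTotal hKs hH j) ≤
      cupIdeal ℂ (ComplexPoints H) (degreeClasses ℂ (ComplexPoints H) {1}) := by
  rw [← kapferMenet2018_ker_pullback_eq_annihilator_of_galois hgal hA Ξ 𝒜 x₀ j hHilb hH hsq hKs]
  exact ker_totalPullback_le_cupIdeal_of_galois hgal hA Ξ 𝒜 x₀ j hHilb hH hsq hKs

/-- **`b₁ = 0` for a generalized Kummer fibre**: `H¹(K(ℂ); ℂ) = 0` — for `m ≥ 1` because `Kᵐ(A)` is irreducible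
symplectic, hence simply connected (Beauville §7 Théorème 4, the named fact
`Beauville1983_irreducibleSymplectic_of_kummerType` through `IsGeneralizedKummerVarietyOf m A K`), for `m = 0`
because `dim K = 0`. [cite: Beauville1983, §7 Théorème 4] [cite: HatcherAT2002, Thm. 2A.1] -/
theorem complexBetti_one_eq_zero_of_kummerFibre (hBe : Beauville1983_irreducibleSymplectic_of_kummerType)
    (hA : A.dim = 2) (Ξ : (A.X ⊗ H).left.IdealSheafData) (𝒜 : Motives.Jacobian H)
    (x₀ : 𝟙_ (SchemeOver ℂ) ⟶ H) (j : K ⟶ H) (hHilb : IsHilbertSchemeOfPoints (m + 1) A.X H Ξ)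
    (hH : IsSmoothProjective (2 * (m + 1)) H)
    (hsq : IsPullback j (toUnit K) (lift (𝟙 H) (toUnit H ≫ x₀) ≫ 𝒜.diff) (1 : 𝟙_ (SchemeOver ℂ) ⟶ 𝒜.J.X))
    (hKs : IsSmoothProjective (2 * m) K) (w : complexBetti K 1) : w = 0 := by
  cases m with
  | zero =>
    haveI := HodgeTheory.subsingleton_complexBetti hKs (k := 1) (by norm_num)
    exact Subsingleton.elim _ _
  | succ m' =>
    have hKum : IsGeneralizedKummerVarietyOf (m' + 1) A K := ⟨H, Ξ, 𝒜, x₀, j, hHilb, hH, hsq⟩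
    have hI := Beauville1983_irreducibleSymplectic_of_kummerType.generalizedKummer hBe (Nat.succ_pos m') hA hKum hKs
    haveI : SimplyConnectedSpace (ComplexPoints K) := hI.2.1
    haveI := ModuleCat.subsingleton_of_isZero
      (isZero_singularCohomology_one_of_simplyConnectedSpace (X := ComplexPoints K) ℂ)
    exact Subsingleton.elim w 0

/-- **Kapfer–Menet Prop. 5.7 (the named fact `KapferMenet2018_annihilator_eq_idealH1`) follows from Beauville's
two theorems** — the Galois cover `Beauville1983_kummerCover_galois` (for `⊆`) and the irreducible symplectic
structure of `Kᵐ(A)` `Beauville1983_irreducibleSymplectic_of_kummerType` (for `⊇`, through `b₁(K) = 0` and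
`cupIdeal_degreeOne_le_cupAnnihilator_of_h1`).  "The annihilator of `[K_{n−1}(A)]` in `H*(A^[n], ℚ)` is the ideal
generated by `H¹(A^[n])`."  Nothing here discharges the two Beauville facts.
[cite: KapferMenet2018, Prop. 5.7 pp. 13–14] [cite: Beauville1983, §7 p. 769 footnote 2 and Théorème 4] -/
theorem kapferMenet2018_annihilator_eq_idealH1_of_facts (hBe : Beauville1983_irreducibleSymplectic_of_kummerType)
    (hgal : Beauville1983_kummerCover_galois) : KapferMenet2018_annihilator_eq_idealH1 := by
  intro m A K H hA Ξ 𝒜 x₀ j hHilb hH hsq hKs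
  exact le_antisymm (cupAnnihilator_le_cupIdeal_of_galois hgal hA Ξ 𝒜 x₀ j hHilb hH hsq hKs)
    (cupIdeal_degreeOne_le_cupAnnihilator_of_h1 hKs hH j
      (complexBetti_one_eq_zero_of_kummerFibre hBe hA Ξ 𝒜 x₀ j hHilb hH hsq hKs))

/-- **The headline `ker θ^* = ⟨H¹(A^[n])⟩`** ("the kernel of `θ*` is the ideal generated by `H¹(A^[3], ℤ)`" in the
introduction — here over `ℂ`, every `n ≥ 1`) modulo Beauville's two theorems (Props. 5.5 and 5.7 in their
conditional forms, through `ker_pullback_eq_idealH1`). [cite: KapferMenet2018, §1 and Props. 5.5, 5.7] -/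
theorem ker_pullback_eq_idealH1_of_facts (hBe : Beauville1983_irreducibleSymplectic_of_kummerType)
    (hgal : Beauville1983_kummerCover_galois) (hA : A.dim = 2)
    (Ξ : (A.X ⊗ H).left.IdealSheafData) (𝒜 : Motives.Jacobian H) (x₀ : 𝟙_ (SchemeOver ℂ) ⟶ H) (j : K ⟶ H)
    (hHilb : IsHilbertSchemeOfPoints (m + 1) A.X H Ξ) (hH : IsSmoothProjective (2 * (m + 1)) H)
    (hsq : IsPullback j (toUnit K) (lift (𝟙 H) (toUnit H ≫ x₀) ≫ 𝒜.diff) (1 : 𝟙_ (SchemeOver ℂ) ⟶ 𝒜.J.X))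
    (hKs : IsSmoothProjective (2 * m) K) :
    LinearMap.ker (totalPullback ℂ (AlgPoints.mapContinuous (L := ℂ) j)) =
      cupIdeal ℂ (ComplexPoints H) (degreeClasses ℂ (ComplexPoints H) {1}) :=
  ker_pullback_eq_idealH1 (kapferMenet2018_ker_pullback_eq_annihilator_of_galois hgal)
    (kapferMenet2018_annihilator_eq_idealH1_of_facts hBe hgal) hA Ξ 𝒜 x₀ j hHilb hH hsq hKs

end KapferMenet

/-! ### §4 `θ^*` is onto `H²(Kᵐ(A))` and `H³(Kᵐ(A))`, `m ≥ 2` (Beauville §7 Prop. 8 / Kapfer–Menet Prop. 5.12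
over `ℂ`), modulo the Galois cover and the BNWS–Oguiso–Foster fact -/

section Surjective

variable {m : ℕ} {A : AbelianVariety ℂ} {K H : SchemeOver ℂ}

/-- **`θ^* : Hᵏ(A^[m+1](ℂ); ℂ) → Hᵏ(Kᵐ(A)(ℂ); ℂ)` is onto for `k = 2, 3` and `m ≥ 2`**, modulo the named facts
`Beauville1983_kummerCover_galois` (the deck transformations of Beauville's cover are `(t_{b⁻¹} × τ_b)(ℂ)` with
`τ_b` the Kummer translation by `b ∈ A[m+1]`) and `BNWS2011_autFixingH2H3_generalizedKummer` (clause 1: every such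
`τ_b` acts trivially on `H²(K)` and `H³(K)`): a class fixed by all `τ_b` is a restriction from `H`
(`exists_complexBetti_map_eq_of_forall_deck_snd`).  In degree `2` this is Beauville's "l'homomorphisme
`k* : H²(A^[r+1]) → H²(K_r)` est surjectif" (proof of Prop. 8, p. 770, `r ≥ 2`, complex coefficients) = the first
sentence of the proof of Kapfer–Menet Prop. 5.12 ("By [Beauville], `θ* : H²(A^[n], ℂ) → H²(K_{n−1}(A), ℂ)` is
surjective"); the integral statement of Prop. 5.12 is not recorded.  Degree `3` is the same argument on clause 1
of the BNWS–Oguiso–Foster fact (for the fourfold compare Kapfer–Menet Prop. 5.14: a basis of `H³(K₂(A), ℤ)` of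
restricted classes).
[cite: Beauville1983, §7 Prop. 8 (proof, p. 770)] [cite: KapferMenet2018, Prop. 5.12 p. 14 and Prop. 5.14]
[cite: BoissiereNieperWisskirchenSarti2011, Cor. 3.3] -/
theorem complexBetti_map_kummerFibre_surjective_of_facts (hBN : BNWS2011_autFixingH2H3_generalizedKummer)
    (hgal : Beauville1983_kummerCover_galois) (hA : A.dim = 2) (hm : 2 ≤ m)
    (Ξ : (A.X ⊗ H).left.IdealSheafData) (𝒜 : Motives.Jacobian H) (x₀ : 𝟙_ (SchemeOver ℂ) ⟶ H) (j : K ⟶ H)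
    (hHilb : IsHilbertSchemeOfPoints (m + 1) A.X H Ξ) (hH : IsSmoothProjective (2 * (m + 1)) H)
    (hsq : IsPullback j (toUnit K) (lift (𝟙 H) (toUnit H ≫ x₀) ≫ 𝒜.diff) (1 : 𝟙_ (SchemeOver ℂ) ⟶ 𝒜.J.X))
    (hKs : IsSmoothProjective (2 * m) K) {k : ℕ} (hk : k = 2 ∨ k = 3) :
    Function.Surjective (complexBetti.map j k) := by
  intro y
  classical
  have hact : IsTranslationAction Ξ (translationAction hHilb) := isTranslationAction_translationAction hHilb
  obtain ⟨G, _, _, _, c, hc, -, hdeck, -⟩ := hgal hA Ξ 𝒜 x₀ j (translationAction hHilb) hHilb hH hsq hKs hact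
  have hB := (hBN hA hm Ξ 𝒜 x₀ j (translationAction hHilb) hHilb hH hsq hKs hact).1
  refine exists_complexBetti_map_eq_of_forall_deck_snd c hc (hact.lift_one_id_comp_kummerCover hHilb j) k y
    fun g ↦ ?_
  obtain ⟨b, τ, hb, hτ, hg⟩ := hdeck g
  obtain ⟨-, h2, h3⟩ := hB b τ hb hτ
  refine ⟨b⁻¹, τ, hg, ?_⟩
  rcases hk with rfl | rfl
  · rw [h2]; rfl
  · rw [h3]; rfl

end Surjective

end Literature.AlgebraicGeometry.Hyperkaehler

end
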